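import Mathlib
import Summits.Ventures.HodgeRepro0.P5S4TransportBasic
import Summits.Ventures.HodgeRepro0.P5S4Transport
import Summits.Ventures.HodgeRepro0.P8SimpleRows192Tbl

/-!
# P8SimpleRows192 — the explicit carrier of the TENTH row (2; 24; 24; [4]) of the simple eightfold, kernel-checked
(cell pub-hodge-repro0, seat p8 (g7); completes P8SimpleRows16 / 32 / 48 / 64 + P8SimpleQuarticRow: every row of
Theorem 2.1 (continued, PART 3) now has a kernel-checked explicit carrier; the table of `T` is `P8SimpleRows192Tbl`)

The configuration: `S = Fin 16` (pair `j` = the points `j`, `j + 8`), `ι = (j ↦ j + 8)`, `T` the group of order 192 of class #32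
of trans8-p8.jsonl (the second code path's run, kit j253748, STATUS l.2427; by that run the smallest `|T|` carrying the row — the
minimality is NOT certified here), `Φ = [0, 2, 3, 4, 5, 6, 7, 9]`, `Δ = [0, 1, 5, 12]`, in the vocabulary of `P5S4Transport`
(Def 1.1 / Def 10.8 of the census). The encoding differs from the four earlier files (a 192-element `Finset` literal is beyond
`decide +kernel`: every closure / content check there is quadratic in `|T|` on `Equiv.Perm` comparisons):
* `T = univ.map ⟨el, _⟩` for the explicit table `el : Fin 192 → Equiv.Perm S` of `P8SimpleRows192Tbl` (`e0 = 1`); `el` is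
  injective because the key `(t 0, t 1, t 2)` takes 192 distinct values (`key_card`, one dedup of 192 naturals);
* closure: `el i * gens k = el (rg k i)` for the four generators (`rg_spec`, 768 equalities of permutations) and every `el i` is a
  positive word in the generators (`word_spec`, 192 equalities) — `mul_mem_T` follows by induction on the word (`mul_wordProd_mem`);
  inverses by the table `invIdx` (`invIdx_spec`); `ι` central by 192 equalities;
* `H_Δ`: the induced types `phi T Φ s` are read as Bool tables over the 192 indices (`phiB`); `content` is the image of the
  Bool-table content under the injective `ofB` (`content_eq`, `ofB_injective`), so `HDelta T Φ Δ = T.filter (contentB (hΔ) = contentB Δ)`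
  (`HDelta_eq`) and its cardinality is a comparison of 192-entry Bool tables instead of 96-element sets of permutations.
Certified, exactly as in the earlier files: `card_T = 192`, `one_mem_T`, `mul_mem_T`, `inv_mem_T`, `iota_mem_T`, `iota_central`,
`T_trans` (transitive on the 16 points), `Φ_cm_type` (`ιΦ = Φᶜ`), `Φ_stab_card = 24` (the number of `t ∈ T` fixing `Φ` setwise —
only the number; the primitivity of the TYPE is a paper step), and for `Δ`: `Balanced T Φ 2 Δ`, `Primitive T Φ 2 Δ`, `|O| = 24`,
`|Stab| = 8`, `|H_Δ| = 8` (so `[K_Δ:ℚ] = 192/8 = 24`), `ι ∉ Stab`, `ι ∉ H_Δ`, `hsizes = {4, 4, 4, 4}` (H-partition `[4]`) and the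
bundled `row ι T Φ Δ = (24, 8, 8, false, false, {4, 4, 4, 4})` = the row `(2; 24; 24; [4])`.
NOT certified: the Kubota rank (degenerate by (C4), paper), that `Δ` is up to the `T`-action the only primitive orbit of the
configuration, the minimality of `|T|`, anything about the census figures or about algebraicity.
-/

namespace HodgeRepro0.P8SimpleRows192

open Finset HodgeRepro0.P5S4Transport

/-- the FILTER form of `Balanced` (an `abbrev`, so decidable by unfolding) -/
abbrev BalancedF (T : Finset (Equiv.Perm S)) (Φ : Finset S) (p : ℕ) (Δ : Finset S) : Prop :=
  Δ.card = 2 * p ∧ T.filter (fun t => (smulF t Δ ∩ Φ).card ≠ p) = ∅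

/-- `BalancedF` is `Balanced` -/
theorem balancedF_iff (T : Finset (Equiv.Perm S)) (Φ : Finset S) (p : ℕ) (Δ : Finset S) :
    BalancedF T Φ p Δ ↔ P5S4Transport.Balanced T Φ p Δ := by
  unfold BalancedF P5S4Transport.Balanced
  rw [Finset.filter_eq_empty_iff]
  simp only [not_not]

/-- the filter form of `Primitive`: balanced, and no proper nonempty subset `Δ₁` is balanced for `q = |Δ₁| / 2` -/
abbrev PrimitiveF (T : Finset (Equiv.Perm S)) (Φ : Finset S) (p : ℕ) (Δ : Finset S) : Prop :=
  BalancedF T Φ p Δ ∧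
    Δ.powerset.filter (fun Δ₁ => Δ₁ ≠ Δ ∧ Δ₁.Nonempty ∧ BalancedF T Φ (Δ₁.card / 2) Δ₁) = ∅

/-- `PrimitiveF` implies `Primitive`: a balanced subset of size `2q` has `q = |Δ₁| / 2` -/
theorem primitive_of_F {T : Finset (Equiv.Perm S)} {Φ : Finset S} {p : ℕ} {Δ : Finset S} (h : PrimitiveF T Φ p Δ) :
    P5S4Transport.Primitive T Φ p Δ := by
  refine ⟨(balancedF_iff T Φ p Δ).mp h.1, fun Δ₁ hsub hne q hbal => ?_⟩
  have hcard : Δ₁.card = 2 * q := hbal.1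
  have hq : Δ₁.card / 2 = q := by omega
  have h2 := Finset.filter_eq_empty_iff.mp h.2 (Finset.mem_powerset.mpr hsub.subset)
  exact h2 ⟨ne_of_lt hsub, hne, (balancedF_iff T Φ _ Δ₁).mpr (hq ▸ hbal)⟩

namespace C192


/-- the key `(t 0, t 1, t 2)` of a table element, packed into a natural number -/
def key (i : Fin 192) : ℕ := (el i 0).val * 256 + (el i 1).val * 16 + (el i 2).val

/-- the 192 keys are distinct -/
theorem key_card : ((univ : Finset (Fin 192)).image key).card = 192 := by decide +kernel

/-- the table is injective (its keys are) -/
theorem el_injective : Function.Injective el := by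
  have h : Set.InjOn key (univ : Finset (Fin 192)) :=
    Finset.card_image_iff.mp (by rw [key_card, Finset.card_univ, Fintype.card_fin])
  intro i j hij
  exact h (Finset.mem_univ i) (Finset.mem_univ j) (by unfold key; rw [hij])

/-- the table as an embedding -/
def elEmb : Fin 192 ↪ Equiv.Perm S := ⟨el, el_injective⟩

/-- the group `T` of the configuration (`|T| = 192`), as the image of the table -/
def T : Finset (Equiv.Perm S) := (univ : Finset (Fin 192)).map elEmb

/-- membership in `T`: the table elements -/
theorem mem_T_iff {t : Equiv.Perm S} : t ∈ T ↔ ∃ i, el i = t := by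
  simp [T, elEmb]

/-- every table element is in `T` -/
theorem el_mem_T (i : Fin 192) : el i ∈ T := mem_T_iff.mpr ⟨i, rfl⟩

/-- the CM type `Φ` (one point of each pair) -/
def Φ : Finset S := {0, 2, 3, 4, 5, 6, 7, 9}

/-- `|T| = 192` -/
theorem card_T : T.card = 192 := by simp [T]
/-- `e0 = 1` -/
theorem e0_eq_one : el 0 = 1 := by decide +kernel
/-- `1 ∈ T` -/
theorem one_mem_T : (1 : Equiv.Perm S) ∈ T := mem_T_iff.mpr ⟨0, e0_eq_one⟩

/-- the right-multiplication table is correct (768 equalities of permutations) -/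
theorem rg_spec : ∀ k : Fin 4, ∀ i : Fin 192, el i * gens k = el (rg k i) := by decide +kernel

/-- the product of a positive word in the generators -/
def wordProd : List (Fin 4) → Equiv.Perm S
  | [] => 1
  | k :: w => gens k * wordProd w

/-- the words are correct (192 equalities of permutations) -/
theorem word_spec : ∀ i : Fin 192, wordProd (word i) = el i := by decide +kernel

/-- a table element times a positive word is a table element -/
theorem mul_wordProd_mem (w : List (Fin 4)) : ∀ i : Fin 192, ∃ j : Fin 192, el i * wordProd w = el j := by
  induction w with
  | nil => intro i; exact ⟨i, by simp [wordProd]⟩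
  | cons k w ih =>
    intro i
    obtain ⟨j, hj⟩ := ih (rg k i)
    exact ⟨j, by rw [wordProd, ← mul_assoc, rg_spec k i, hj]⟩

/-- `T` is closed under products -/
theorem mul_mem_T : ∀ s ∈ T, ∀ t ∈ T, s * t ∈ T := by
  intro s hs t ht
  obtain ⟨i, rfl⟩ := mem_T_iff.mp hs
  obtain ⟨j, rfl⟩ := mem_T_iff.mp ht
  obtain ⟨m, hm⟩ := mul_wordProd_mem (word j) i
  rw [word_spec] at hm
  rw [hm]
  exact el_mem_T m

/-- the inverse table is correct: `el i * el (invIdx i) = 1` -/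
theorem invIdx_spec : ∀ i : Fin 192, el i * el (invIdx i) = 1 := by decide +kernel

/-- `T` is closed under inverses -/
theorem inv_mem_T : ∀ t ∈ T, t⁻¹ ∈ T := by
  intro t ht
  obtain ⟨i, rfl⟩ := mem_T_iff.mp ht
  rw [inv_eq_of_mul_eq_one_right (invIdx_spec i)]
  exact el_mem_T _

/-- `ι` is element 103 of the table -/
theorem el_iota : el 103 = ι := by decide +kernel
/-- `ι ∈ T` -/
theorem iota_mem_T : ι ∈ T := mem_T_iff.mpr ⟨103, el_iota⟩
/-- `ι` commutes with every table element (192 equalities) -/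
theorem iota_central_tbl : ∀ i : Fin 192, el i * ι = ι * el i := by decide +kernel
/-- `ι` is central in `T` -/
theorem iota_central : ∀ t ∈ T, t * ι = ι * t := by
  intro t ht
  obtain ⟨i, rfl⟩ := mem_T_iff.mp ht
  exact iota_central_tbl i
/-- `T` is transitive on the 16 points -/
theorem T_trans : ∀ y : S, ∃ t ∈ T, t 0 = y := by decide +kernel
/-- `Φ` is a CM type: `ιΦ` is the complement of `Φ` -/
theorem Φ_cm_type : smulF ι Φ = Φᶜ := by decide +kernel
/-- the elements of `T` stabilising `Φ` setwise: exactly 24 -/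
theorem Φ_stab_card : (T.filter (fun t => smulF t Φ = Φ)).card = 24 := by decide +kernel

/-- the induced type `φ_s = {t ∈ T : t s ∈ Φ}` read as a Bool table over the indices -/
def phiB (s : S) : Fin 192 → Bool := fun i => decide (el i s ∈ Φ)

/-- a Bool table back to the set of table elements it marks -/
def ofB (b : Fin 192 → Bool) : Finset (Equiv.Perm S) := ((univ : Finset (Fin 192)).filter (fun i => b i = true)).map elEmb

/-- `ofB` is injective -/
theorem ofB_injective : Function.Injective ofB := by
  intro b b' h
  have h2 := Finset.map_injective elEmb h
  funext i
  have h3 := congrArg (fun s => i ∈ s) h2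
  simp only [Finset.mem_filter, Finset.mem_univ, true_and, eq_iff_iff] at h3
  cases hb : b i <;> cases hb' : b' i <;> simp_all

/-- the induced type is the set marked by its Bool table -/
theorem phi_eq_ofB (s : S) : phi T Φ s = ofB (phiB s) := by
  unfold phi ofB phiB T
  rw [Finset.filter_map]
  congr 1
  ext i
  simp [elEmb]

/-- the Bool-table content of a set of points -/
def contentB (Δ : Finset S) : Multiset (Fin 192 → Bool) := Δ.val.map phiB

/-- the content is the image of the Bool-table content under `ofB` -/
theorem content_eq (Δ : Finset S) : content T Φ Δ = (contentB Δ).map ofB := by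
  unfold content contentB
  rw [Multiset.map_map]
  congr 1
  funext s
  exact phi_eq_ofB s

/-- `H_Δ` as a filter on Bool-table contents -/
theorem HDelta_eq (Δ : Finset S) : HDelta T Φ Δ = T.filter (fun h => contentB (smulF h Δ) = contentB Δ) := by
  unfold HDelta
  apply Finset.filter_congr
  intro h _
  rw [content_eq, content_eq]
  exact (Multiset.map_injective ofB_injective).eq_iff

/-- the primitive balanced set of the row `(2; 24; 24; [4])` -/
def Δ_r2_24_24_4 : Finset S := {0, 1, 5, 12}
/-- `Δ` is a balanced `4`-set (`p = 2`) -/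
theorem balanced_r2_24_24_4 : P5S4Transport.Balanced T Φ 2 Δ_r2_24_24_4 := (balancedF_iff T Φ 2 Δ_r2_24_24_4).mp (by decide +kernel)
/-- `Δ` is primitive -/
theorem primitive_r2_24_24_4 : P5S4Transport.Primitive T Φ 2 Δ_r2_24_24_4 := primitive_of_F (by decide +kernel)
/-- `|O| = 24` -/
theorem card_orbit_r2_24_24_4 : (orbit T Δ_r2_24_24_4).card = 24 := by decide +kernel
/-- `|Stab_T(Δ)| = 8` -/
theorem card_stab_r2_24_24_4 : (stab T Δ_r2_24_24_4).card = 8 := by decide +kernel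
/-- `|H_Δ| = 8` in the Bool-table form -/
theorem card_HDelta_B_r2_24_24_4 : (T.filter (fun h => contentB (smulF h Δ_r2_24_24_4) = contentB Δ_r2_24_24_4)).card = 8 := by
  decide +kernel
/-- `|H_Δ| = 8`, so `[K_Δ:ℚ] = 192 / 8 = 24` -/
theorem card_HDelta_r2_24_24_4 : (HDelta T Φ Δ_r2_24_24_4).card = 8 := by
  rw [HDelta_eq]; exact card_HDelta_B_r2_24_24_4
/-- `ι ∉ Stab_T(Δ)` -/
theorem iota_not_mem_stab_r2_24_24_4 : ι ∉ stab T Δ_r2_24_24_4 := by decide +kernel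
/-- `ι ∉ H_Δ` (Bool-table form) -/
theorem iota_not_mem_HDelta_B_r2_24_24_4 : ι ∉ T.filter (fun h => contentB (smulF h Δ_r2_24_24_4) = contentB Δ_r2_24_24_4) := by
  decide +kernel
/-- `ι ∉ H_Δ` -/
theorem iota_not_mem_HDelta_r2_24_24_4 : ι ∉ HDelta T Φ Δ_r2_24_24_4 := by
  rw [HDelta_eq]; exact iota_not_mem_HDelta_B_r2_24_24_4
/-- the H-partition `[4]` (orbit sizes over the points of `Δ`) -/
theorem hsizes_r2_24_24_4 : hsizes T Δ_r2_24_24_4 = {4, 4, 4, 4} := by decide +kernel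
/-- the bundled row `(|O|, |Stab|, |H_Δ|, [ι ∈ Stab], [ι ∈ H_Δ], orbit sizes)` = the row `(2; 24; 24; [4])` -/
theorem row_r2_24_24_4 : row ι T Φ Δ_r2_24_24_4 = (24, 8, 8, false, false, {4, 4, 4, 4}) := by
  unfold row
  rw [card_orbit_r2_24_24_4, card_stab_r2_24_24_4, card_HDelta_r2_24_24_4, hsizes_r2_24_24_4,
    decide_eq_false iota_not_mem_stab_r2_24_24_4, decide_eq_false iota_not_mem_HDelta_r2_24_24_4]

end C192

end HodgeRepro0.P8SimpleRows192
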